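import Summits.CriticalPhenomena.PercolationContinuityZ3.Theorems.PercNearOneGluingNoHeavyLowerTailRootedSequential
import HarnessLib

/-!
# `NoHeavyLowerTail` (stmt-CriticalPhenomena-4575) — the rooted exchange WITH SLACK: quantitative (DC) bounds at doubly glued faces

Support file (prover `prim-hp-3`, hull-port line; `--supports stmt-CriticalPhenomena-4575`).  No definitions, no named facts, no sorries.

Notation: `μ_w = prodBernoulli w`, relays `A`, level `j`, `R_x = {|π(x)| ≤ j}`, `I(x) = μ(R_x)`; observer set `O = {o, o'}`, E-mass
`E(v) = μ(v ↮ O, 1 ≤ |π(O)| ≤ j) + μ(v ↔ O, |π(v)| ≤ j)`, and the FREE ROOM of `v` w.r.t. `t`: `F_t(v) = μ(v ↮ O, |π(t)| ≤ j < |π(O)|)`.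

* `HullPort.coreExchange_slack` — for `p ≠ t` and every `v`, WITHOUT any domination hypothesis,
  `μ(p ↮ t, p ↔ v, R_p, ¬R_t) ≤ μ(p ↮ t, p ↔ v, R_t, ¬R_p) + [I(p) − I(t)]⁺`
  (BHK two-cluster exchange as in `coreExchange`; the defect of the base comparison passes through linearly because the right event has mass at most
  `μ(p ↮ t, R_t, ¬R_p)`).
* `HullPort.obsE_add_free_le_of_doublyGlued` — `w s(o,t) = 1`, `w s(o',p) = 1`, `p ≠ t`: for every `v`,
  `E(v) + F_t(v) ≤ I(t) + [I(p) − I(t)]⁺`.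
  (The E-event, the free room and the right exchange event are pairwise disjoint inside `R_t` a.s.; the part of the E-event outside `R_t` is the left exchange event.)
WHY (crux notes `HULLPORT-REF-gen6.md` §16–17): summing these bounds over the first-open-pair decomposition of the second star gives, at the glued face of the champion's
pair, `E_1(v) ≤ I_1(t) + Δ_1 − F_1(v)` with the v-INDEPENDENT defect `Δ_1 = Σ_l P(F_l)[I_{1,l}(p_l) − I_{1,l}(t)]⁺`; the resulting quantitative champion-edge criterion
`c(Δ_1 − F_1(v)) ≤ (1−c)(I_0(t) − E_0(v))` has 0 failures in the seat census including the entire residual of the qualitative criteria.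
-/

noncomputable section

namespace Summit.CriticalPhenomena.PercolationContinuityZ3.Theorems

open MeasureTheory Set Literature.Probability.LatticeModels Literature.Probability.Percolation
open scoped Classical BigOperators

variable {n : ℕ}

namespace HullPort

/-- **Three-vertex exchange with slack.**  `p ≠ t`: for every `v`,
`μ(p ↮ t, p ↔ v, R_p, ¬R_t) ≤ μ(p ↮ t, p ↔ v, R_t, ¬R_p) + max 0 (I(p) − I(t))`.
[cite: VandenbergHaggstromKahn2005, Thm. 1.5 (p. 7) — via `twoClusterExchange`; this work] -/
theorem coreExchange_slack (w : Sym2 (Fin n) → unitInterval) (A : Finset (Fin n)) (p t v : Fin n) (j : ℕ) (hpt : p ≠ t) :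
    (prodBernoulli w).real ((openConn p t : Set (BondConfig (Fin n)))ᶜ ∩ ((openConn p v : Set (BondConfig (Fin n))) ∩
        ({ω : BondConfig (Fin n) | (A.filter fun z => ω ∈ openConn p z).card ≤ j} ∩
          {ω : BondConfig (Fin n) | (A.filter fun z => ω ∈ openConn t z).card ≤ j}ᶜ))) ≤
      (prodBernoulli w).real ((openConn p t : Set (BondConfig (Fin n)))ᶜ ∩ ((openConn p v : Set (BondConfig (Fin n))) ∩
        ({ω : BondConfig (Fin n) | (A.filter fun z => ω ∈ openConn t z).card ≤ j} ∩
          {ω : BondConfig (Fin n) | (A.filter fun z => ω ∈ openConn p z).card ≤ j}ᶜ))) +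
      max 0 ((prodBernoulli w).real {ω : BondConfig (Fin n) | (A.filter fun z => ω ∈ openConn p z).card ≤ j} -
        (prodBernoulli w).real {ω : BondConfig (Fin n) | (A.filter fun z => ω ∈ openConn t z).card ≤ j}) := by
  set μ := prodBernoulli w with hμ
  set D : Set (BondConfig (Fin n)) := (openConn p t : Set (BondConfig (Fin n)))ᶜ with hD
  set Rp := {ω : BondConfig (Fin n) | (A.filter fun z => ω ∈ openConn p z).card ≤ j} with hRp
  set Rt := {ω : BondConfig (Fin n) | (A.filter fun z => ω ∈ openConn t z).card ≤ j} with hRt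
  set X : Set (BondConfig (Fin n)) := (openConn p v : Set (BondConfig (Fin n))) with hX
  have hmeas : ∀ S : Set (BondConfig (Fin n)), MeasurableSet S := fun S => (Set.toFinite S).measurableSet
  have key := twoClusterExchange w hpt (A₁ := X) (A₂ := Rt ∩ Rpᶜ) (B₁ := Rp ∩ Rtᶜ) (B₂ := (univ : Set (BondConfig (Fin n))))
    (fun ω ω' hs ht hω => typePlus_openConn p t v hs ht hω)
    (fun ω ω' hs ht hω => ⟨LonelyClusterExchange.typePlus_card_le A j p t hs ht hω.1,
      fun h' => hω.2 (LonelyClusterExchange.typeMinus_card_le A j p t hs ht h')⟩)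
    (fun ω ω' hs ht hω => ⟨LonelyClusterExchange.typeMinus_card_le A j p t hs ht hω.1,
      fun h' => hω.2 (LonelyClusterExchange.typePlus_card_le A j p t hs ht h')⟩)
    (fun _ _ _ _ _ => mem_univ _)
  simp only [inter_univ] at key
  -- `d - b = I(p) - I(t)` where `d = μ(D ∩ Rp ∩ Rtᶜ)`, `b = μ(D ∩ Rt ∩ Rpᶜ)`
  have hsep := CutObserver.lightness_sub_eq_sep w A p t j
  have hcomm : (openConn t p : Set (BondConfig (Fin n))) = openConn p t := knThm2_openConn_comm t p
  rw [hcomm] at hsep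
  have h1 : μ.real (D ∩ Rp ∩ Rt) + μ.real ((D ∩ Rp) \ Rt) = μ.real (D ∩ Rp) := measureReal_inter_add_sdiff (hmeas Rt)
  have h2 : μ.real (D ∩ Rt ∩ Rp) + μ.real ((D ∩ Rt) \ Rp) = μ.real (D ∩ Rt) := measureReal_inter_add_sdiff (hmeas Rp)
  have e12 : D ∩ Rp ∩ Rt = D ∩ Rt ∩ Rp := by ext ω; simp only [mem_inter_iff]; tauto
  have eB : (D ∩ Rp) \ Rt = D ∩ (Rp ∩ Rtᶜ) := by ext ω; simp only [mem_inter_iff, mem_sdiff, mem_compl_iff]; tauto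
  have eA : (D ∩ Rt) \ Rp = D ∩ (Rt ∩ Rpᶜ) := by ext ω; simp only [mem_inter_iff, mem_sdiff, mem_compl_iff]; tauto
  rw [e12] at h1
  rw [eB] at h1
  rw [eA] at h2
  have hdb : μ.real (D ∩ (Rp ∩ Rtᶜ)) - μ.real (D ∩ (Rt ∩ Rpᶜ)) = μ.real Rp - μ.real Rt := by linarith
  -- the four quantities
  have hsub_a : μ.real (D ∩ (X ∩ (Rp ∩ Rtᶜ))) ≤ μ.real (D ∩ (Rp ∩ Rtᶜ)) :=
    measureReal_mono (fun ω hω => ⟨hω.1, hω.2.2⟩) (measure_ne_top _ _)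
  have hsub_c : μ.real (D ∩ (X ∩ (Rt ∩ Rpᶜ))) ≤ μ.real (D ∩ (Rt ∩ Rpᶜ)) :=
    measureReal_mono (fun ω hω => ⟨hω.1, hω.2.2⟩) (measure_ne_top _ _)
  have ha : 0 ≤ μ.real (D ∩ (X ∩ (Rp ∩ Rtᶜ))) := measureReal_nonneg
  have hc : 0 ≤ μ.real (D ∩ (X ∩ (Rt ∩ Rpᶜ))) := measureReal_nonneg
  have hb : 0 ≤ μ.real (D ∩ (Rt ∩ Rpᶜ)) := measureReal_nonneg
  have hmax : μ.real Rp - μ.real Rt ≤ max 0 (μ.real Rp - μ.real Rt) := le_max_right _ _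
  have hmax0 : 0 ≤ max 0 (μ.real Rp - μ.real Rt) := le_max_left _ _
  by_cases hbz : μ.real (D ∩ (Rt ∩ Rpᶜ)) = 0
  · -- then `c = 0` and `a ≤ d = (I(p) - I(t)) + b = I(p) - I(t)`
    have : μ.real (D ∩ (X ∩ (Rp ∩ Rtᶜ))) ≤ μ.real Rp - μ.real Rt := by linarith
    linarith
  · have hbpos : 0 < μ.real (D ∩ (Rt ∩ Rpᶜ)) := lt_of_le_of_ne hb (Ne.symm hbz)
    -- `a b ≤ c d = c b + c (d - b) ≤ c b + b (d - b)⁺`, divide by `b`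
    have hcd : μ.real (D ∩ (X ∩ (Rt ∩ Rpᶜ))) * (μ.real (D ∩ (Rp ∩ Rtᶜ)) - μ.real (D ∩ (Rt ∩ Rpᶜ))) ≤
        μ.real (D ∩ (Rt ∩ Rpᶜ)) * max 0 (μ.real Rp - μ.real Rt) := by
      rw [hdb]
      calc μ.real (D ∩ (X ∩ (Rt ∩ Rpᶜ))) * (μ.real Rp - μ.real Rt)
          ≤ μ.real (D ∩ (X ∩ (Rt ∩ Rpᶜ))) * max 0 (μ.real Rp - μ.real Rt) := mul_le_mul_of_nonneg_left hmax hc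
        _ ≤ μ.real (D ∩ (Rt ∩ Rpᶜ)) * max 0 (μ.real Rp - μ.real Rt) := mul_le_mul_of_nonneg_right hsub_c hmax0
    have hk : μ.real (D ∩ (X ∩ (Rp ∩ Rtᶜ))) * μ.real (D ∩ (Rt ∩ Rpᶜ)) ≤
        (μ.real (D ∩ (X ∩ (Rt ∩ Rpᶜ))) + max 0 (μ.real Rp - μ.real Rt)) * μ.real (D ∩ (Rt ∩ Rpᶜ)) := by
      nlinarith [key, hcd]
    exact le_of_mul_le_mul_right hk hbpos

/-- **Doubly glued, with slack and free room.**  `o ≠ t`, `o' ≠ p`, `p ≠ t`, `w s(o,t) = 1`, `w s(o',p) = 1`: for `O = {o, o'}` and every `v`,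
`E(v) + μ(v ↮ O, |π(t)| ≤ j < |π(O)|) ≤ I(t) + max 0 (I(p) − I(t))`.
[cite: VandenbergHaggstromKahn2005, Thm. 1.5 (p. 7) — via `coreExchange_slack`; this work] -/
theorem obsE_add_free_le_of_doublyGlued (w : Sym2 (Fin n) → unitInterval) (A : Finset (Fin n)) (o o' p t v : Fin n) (j : ℕ)
    (hot : o ≠ t) (hop : o' ≠ p) (hpt : p ≠ t) (hwt : w s(o, t) = 1) (hwp : w s(o', p) = 1) :
    (prodBernoulli w).real {ω : BondConfig (Fin n) | (∀ x ∈ ({o, o'} : Finset (Fin n)), ω ∉ openConn v x) ∧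
        1 ≤ (A.filter fun z => ∃ x ∈ ({o, o'} : Finset (Fin n)), ω ∈ openConn x z).card ∧
        (A.filter fun z => ∃ x ∈ ({o, o'} : Finset (Fin n)), ω ∈ openConn x z).card ≤ j} +
      (prodBernoulli w).real {ω : BondConfig (Fin n) | (∃ x ∈ ({o, o'} : Finset (Fin n)), ω ∈ openConn v x) ∧
        (A.filter fun z => ω ∈ openConn v z).card ≤ j} +
      (prodBernoulli w).real {ω : BondConfig (Fin n) | (∀ x ∈ ({o, o'} : Finset (Fin n)), ω ∉ openConn v x) ∧
        (A.filter fun z => ω ∈ openConn t z).card ≤ j ∧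
        j < (A.filter fun z => ∃ x ∈ ({o, o'} : Finset (Fin n)), ω ∈ openConn x z).card} ≤
      (prodBernoulli w).real {ω : BondConfig (Fin n) | (A.filter fun z => ω ∈ openConn t z).card ≤ j} +
      max 0 ((prodBernoulli w).real {ω : BondConfig (Fin n) | (A.filter fun z => ω ∈ openConn p z).card ≤ j} -
        (prodBernoulli w).real {ω : BondConfig (Fin n) | (A.filter fun z => ω ∈ openConn t z).card ≤ j}) := by
  set μ := prodBernoulli w with hμ
  set O : Finset (Fin n) := {o, o'} with hO
  set X₁ := {ω : BondConfig (Fin n) | (∀ x ∈ O, ω ∉ openConn v x) ∧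
        1 ≤ (A.filter fun z => ∃ x ∈ O, ω ∈ openConn x z).card ∧
        (A.filter fun z => ∃ x ∈ O, ω ∈ openConn x z).card ≤ j} with hX₁
  set X₂ := {ω : BondConfig (Fin n) | (∃ x ∈ O, ω ∈ openConn v x) ∧ (A.filter fun z => ω ∈ openConn v z).card ≤ j} with hX₂
  set Fr := {ω : BondConfig (Fin n) | (∀ x ∈ O, ω ∉ openConn v x) ∧ (A.filter fun z => ω ∈ openConn t z).card ≤ j ∧
        j < (A.filter fun z => ∃ x ∈ O, ω ∈ openConn x z).card} with hFr
  set Rp := {ω : BondConfig (Fin n) | (A.filter fun z => ω ∈ openConn p z).card ≤ j} with hRp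
  set Rt := {ω : BondConfig (Fin n) | (A.filter fun z => ω ∈ openConn t z).card ≤ j} with hRt
  set D : Set (BondConfig (Fin n)) := (openConn p t : Set (BondConfig (Fin n)))ᶜ with hD
  set Xv : Set (BondConfig (Fin n)) := (openConn p v : Set (BondConfig (Fin n))) with hXv
  set Leak : Set (BondConfig (Fin n)) := D ∩ (Xv ∩ (Rp ∩ Rtᶜ)) with hLeak
  set Room : Set (BondConfig (Fin n)) := D ∩ (Xv ∩ (Rt ∩ Rpᶜ)) with hRoom
  set G : Set (BondConfig (Fin n)) := {ω | s(o, t) ∈ ω} ∩ {ω | s(o', p) ∈ ω} with hG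
  have hmeas : ∀ S : Set (BondConfig (Fin n)), MeasurableSet S := fun S => (Set.toFinite S).measurableSet
  -- the good set has full measure
  have hfull : ∀ S : Set (BondConfig (Fin n)), μ.real S ≤ μ.real (S ∩ G) := by
    intro S
    have h1 := edgeSw_real_eq_of_sure w s(o, t) hwt S (S ∩ {ω : BondConfig (Fin n) | s(o, t) ∈ ω})
      (fun ω he => by simp only [mem_inter_iff, mem_setOf_eq]; exact ⟨fun h => ⟨h, he⟩, fun h => h.1⟩)
    have h2 := edgeSw_real_eq_of_sure w s(o', p) hwp (S ∩ {ω : BondConfig (Fin n) | s(o, t) ∈ ω}) (S ∩ G)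
      (fun ω he => by
        simp only [hG, mem_inter_iff, mem_setOf_eq]
        exact ⟨fun h => ⟨h.1, h.2, he⟩, fun h => ⟨h.1, h.2.1⟩⟩)
    rw [h1, h2]
  have hreach_ot : ∀ ω ∈ G, (openGraph ω).Reachable o t := fun ω hω => ((openGraph_adj ω o t).mpr ⟨hω.1, hot⟩).reachable
  have hreach_op : ∀ ω ∈ G, (openGraph ω).Reachable o' p := fun ω hω => ((openGraph_adj ω o' p).mpr ⟨hω.2, hop⟩).reachable
  -- (1) `X₁ ∩ G ⊆ Rt`
  have hX1 : X₁ ∩ G ⊆ Rt ∩ X₁ := by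
    rintro ω ⟨hω, hg⟩
    refine ⟨?_, hω⟩
    simp only [hRt, mem_setOf_eq]
    obtain ⟨-, -, hle'⟩ := hω
    refine le_trans (Finset.card_le_card ?_) hle'
    intro z hz
    rw [Finset.mem_filter] at hz ⊢
    refine ⟨hz.1, o, by simp [hO], ?_⟩
    exact ((hreach_ot ω hg).trans (show (openGraph ω).Reachable t z from hz.2) : (openGraph ω).Reachable o z)
  -- (2) `X₂ ∩ G ⊆ (X₂ ∩ Rt) ∪ Leak`
  have hX2 : X₂ ∩ G ⊆ (X₂ ∩ Rt) ∪ Leak := by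
    rintro ω ⟨hω, hg⟩
    by_cases ht : ω ∈ Rt
    · exact Or.inl ⟨hω, ht⟩
    · right
      obtain ⟨⟨x, hxO, hvx⟩, hLv⟩ := hω
      have hvx' : (openGraph ω).Reachable v x := hvx
      have hvt : ¬ (openGraph ω).Reachable v t := by
        intro h
        apply ht
        simp only [hRt, mem_setOf_eq]
        rw [← filter_openConn_eq_of_reachable A h]
        exact hLv
      have hxo' : x = o' := by
        simp only [hO, Finset.mem_insert, Finset.mem_singleton] at hxO
        rcases hxO with rfl | rfl
        · exact absurd (hvx'.trans (hreach_ot ω hg)) hvt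
        · rfl
      subst hxo'
      have hvp : (openGraph ω).Reachable v p := hvx'.trans (hreach_op ω hg)
      have hpv : ω ∈ (openConn p v : Set (BondConfig (Fin n))) := hvp.symm
      refine ⟨fun h => hvt (hvp.trans h), hpv, ?_, ht⟩
      simp only [hRp, mem_setOf_eq]
      rw [← filter_openConn_eq_of_reachable A hvp]
      exact hLv
  -- (3) `Room ∩ G ⊆ Rt`, disjoint from `X₁`, `X₂`, `Fr`; `Fr ⊆ Rt` disjoint from `X₁`, `X₂`
  have hRoomRt : Room ∩ G ⊆ Rt := fun ω hω => hω.1.2.2.1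
  have hFrRt : Fr ⊆ Rt := fun ω hω => hω.2.1
  have hRoomX1 : ∀ ω ∈ Room ∩ G, ω ∉ X₁ := by
    rintro ω ⟨⟨-, hpv, -⟩, hg⟩ ⟨hnot, -⟩
    have hvp : (openGraph ω).Reachable v p := (show (openGraph ω).Reachable p v from hpv).symm
    exact hnot o' (by simp [hO]) (hvp.trans (hreach_op ω hg).symm)
  have hRoomFr : ∀ ω ∈ Room ∩ G, ω ∉ Fr := by
    rintro ω ⟨⟨-, hpv, -⟩, hg⟩ ⟨hnot, -⟩
    have hvp : (openGraph ω).Reachable v p := (show (openGraph ω).Reachable p v from hpv).symm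
    exact hnot o' (by simp [hO]) (hvp.trans (hreach_op ω hg).symm)
  have hRoomX2 : ∀ ω ∈ Room ∩ G, ω ∉ X₂ := by
    rintro ω ⟨⟨-, hpv, -, hnp⟩, -⟩ ⟨-, hLv⟩
    apply hnp
    have hvp : (openGraph ω).Reachable v p := (show (openGraph ω).Reachable p v from hpv).symm
    simp only [hRp, mem_setOf_eq]
    rw [← filter_openConn_eq_of_reachable A hvp]
    exact hLv
  have hX12 : ∀ ω ∈ X₁, ω ∉ X₂ := by
    rintro ω ⟨hnot, -⟩ ⟨⟨x, hx, hvx⟩, -⟩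
    exact hnot x hx hvx
  have hFrX1 : ∀ ω ∈ Fr, ω ∉ X₁ := by
    rintro ω ⟨-, -, hlt⟩ ⟨-, -, hle⟩
    exact absurd hle (not_le.mpr hlt)
  have hFrX2 : ∀ ω ∈ Fr, ω ∉ X₂ := by
    rintro ω ⟨hnot, -⟩ ⟨⟨x, hx, hvx⟩, -⟩
    exact hnot x hx hvx
  -- (4) the four disjoint pieces of `Rt`
  have hU : μ.real (Rt ∩ X₁) + μ.real (X₂ ∩ Rt) + μ.real Fr + μ.real (Room ∩ G) ≤ μ.real Rt := by
    have hd1 : Disjoint (Rt ∩ X₁) (X₂ ∩ Rt) := by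
      rw [Set.disjoint_left]; rintro ω ⟨-, h1⟩ ⟨h2, -⟩; exact hX12 ω h1 h2
    have hd2 : Disjoint (Rt ∩ X₁ ∪ X₂ ∩ Rt) Fr := by
      rw [Set.disjoint_left]
      rintro ω (⟨-, h1⟩ | ⟨h2, -⟩) hF
      · exact hFrX1 ω hF h1
      · exact hFrX2 ω hF h2
    have hd3 : Disjoint (Rt ∩ X₁ ∪ X₂ ∩ Rt ∪ Fr) (Room ∩ G) := by
      rw [Set.disjoint_left]
      rintro ω ((⟨-, h1⟩ | ⟨h2, -⟩) | hF) hR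
      · exact hRoomX1 ω hR h1
      · exact hRoomX2 ω hR h2
      · exact hRoomFr ω hR hF
    have e1 : μ.real (Rt ∩ X₁ ∪ X₂ ∩ Rt) = μ.real (Rt ∩ X₁) + μ.real (X₂ ∩ Rt) := measureReal_union hd1 (hmeas _)
    have e2 : μ.real (Rt ∩ X₁ ∪ X₂ ∩ Rt ∪ Fr) = μ.real (Rt ∩ X₁ ∪ X₂ ∩ Rt) + μ.real Fr := measureReal_union hd2 (hmeas _)
    have e3 : μ.real (Rt ∩ X₁ ∪ X₂ ∩ Rt ∪ Fr ∪ Room ∩ G) = μ.real (Rt ∩ X₁ ∪ X₂ ∩ Rt ∪ Fr) + μ.real (Room ∩ G) :=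
      measureReal_union hd3 (hmeas _)
    have hsub : Rt ∩ X₁ ∪ X₂ ∩ Rt ∪ Fr ∪ Room ∩ G ⊆ Rt := by
      rintro ω (((⟨h, -⟩ | ⟨-, h⟩) | h) | h)
      · exact h
      · exact h
      · exact hFrRt h
      · exact hRoomRt h
    have h : μ.real (Rt ∩ X₁ ∪ X₂ ∩ Rt ∪ Fr ∪ Room ∩ G) ≤ μ.real Rt := measureReal_mono hsub (measure_ne_top _ _)
    rw [e3, e2, e1] at h
    exact h
  -- (5) the exchange with slack
  have hex := coreExchange_slack w A p t v j hpt
  have hE1' : μ.real (X₁ ∩ G) ≤ μ.real (Rt ∩ X₁) := measureReal_mono hX1 (measure_ne_top _ _)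
  have hE1 : μ.real X₁ ≤ μ.real (Rt ∩ X₁) := (hfull X₁).trans hE1'
  have hE2' : μ.real (X₂ ∩ G) ≤ μ.real ((X₂ ∩ Rt) ∪ Leak) := measureReal_mono hX2 (measure_ne_top _ _)
  have hE2 : μ.real X₂ ≤ μ.real (X₂ ∩ Rt) + μ.real Leak := ((hfull X₂).trans hE2').trans (measureReal_union_le (X₂ ∩ Rt) Leak)
  have hRoomG : μ.real Room ≤ μ.real (Room ∩ G) := hfull Room
  linarith

end HullPort

end Summit.CriticalPhenomena.PercolationContinuityZ3.Theorems

end
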